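import Literature.RepresentationTheory.HeisenbergGroup.StoneVonNeumannLatticePair
import HarnessLib

/-!
# The dual lattice pair of a non-archimedean field: the unit ball `B₁ ⊆ Fⁿ` and its dual `B₁^⊥` for `ψ(x · T y)`, with the
# model-free uniqueness of the irreducible unitary `ψ`-representation of `H(𝕎_v)` as a corollary

Topic `RepresentationTheory/HeisenbergGroup`; namespace `Literature.RepresentationTheory.HeisenbergGroup`.  KERNEL ONLY:
theorems; no definition, no named fact, no record, no `sorry`.

The abstract Stone–von Neumann files `DualLatticePair.lean` / `StoneVonNeumannLatticePair.lean` take as input ONE dual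
lattice pair `(B₁, B₂)` for the pairing `ψ(β x y)` whose unit scalings shrink to `0`.  This file discharges that input
in the setting of the tree's finite-place files (`CharacterDualLattice.lean`, `WeylPairLatticeVector.lean`,
`StoneVonNeumannUniqueness.lean`): `F` a non-archimedean normed field with compact closed balls and a non-zero element
of norm `< 1`, `T ∈ GL_n(F)`, `ψ : F → S¹` continuous and non-trivial, `β_T(x, y) = x · T y`:

* §1 **`isDualLatticePair_closedBall_charDual`**: `(B₁, B₁^⊥)` with `B₁ = {‖x‖ ≤ 1}` and `B₁^⊥ = charDual T ψ B₁` is a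
  dual lattice pair — compactness/openness of `B₁^⊥` and the separation `^⊥(B₁^⊥) = B₁` are `CharacterDualLattice.lean`'s
  `isCompact_charDual_closedBall`, `isOpen_charDual`, `exists_mem_charDual_apply_ne_one`
  ([MoeglinVignerasWaldspurger1987, Chap. 2 I.3] "`(A^⊥)^⊥ = A`"; [Weil1964, Chap. I n° 11] the lattice `L × L_*`);
* §2 **unit scalings shrink to `0`** (`exists_units_smul_addSubgroup_subset`): for a bounded additive subgroup `S` of `Fⁿ`
  and a neighbourhood `N` of `0`, `cᵏ S ⊆ N` for `0 < ‖c‖ < 1` and `k` large;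
* §3 the corollary **`exists_linearIsometryEquiv_of_irreducible_of_irreducible_nonarch`**: any two irreducible unitary
  representations of `H = Heisenberg (polar β_T)` with central character `ψ` (isometric, continuous orbit maps on
  `Fⁿ × Fⁿ`, no closed invariant subspaces other than `⊥`, `⊤`) are unitarily equivalent — the uniqueness of
  [GelbartRogawski1991, §3.1 p. 454 L20–21] at a finite place WITHOUT reference to the Schrödinger model or a Haar
  measure (the tree's `LocalSchrodingerL2Unique.exists_linearIsometryEquiv_of_irreducible_unitary` obtains the same
  through the model `L²(F_vᴺ)`), i.e. the instance `X = Y = Fⁿ` of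
  `exists_linearIsometryEquiv_of_irreducible_of_isDualLatticePair`.

Nothing of the cited sources is asserted; everything is proved from Mathlib and the tree.

## References
* [MoeglinVignerasWaldspurger1987] C. Mœglin, M.-F. Vignéras, J.-L. Waldspurger, LNM 1291 (1987), Chap. 2 I.2, I.3.
* [Weil1964] A. Weil, Acta Math. 111 (1964), Chap. I n° 11.
* [GelbartRogawski1991] S. Gelbart, J. Rogawski, Invent. Math. 105 (1991), §3.1 p. 454 L19–21.
-/

set_option autoImplicit false

noncomputable section

open Matrix Set Filter Topology
open scoped NNReal Pointwise

namespace Literature.RepresentationTheory.HeisenbergGroup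

open SchrodingerIrreducible

variable {F : Type*} [NormedField F] [IsUltrametricDist F] [ProperSpace F] {n : ℕ}
  (T : Matrix (Fin n) (Fin n) F) (ψ : AddChar F Circle)

/-! ## §1 The unit ball and its dual form a dual lattice pair -/

/-- **the dual lattice pair of a finite place**: for `T ∈ GL_n(F)` and `ψ` continuous non-trivial, the unit ball
`B₁ = {x ∈ Fⁿ ; ‖x‖ ≤ 1}` (a compact open additive subgroup) and its dual `B₁^⊥ = {y ; ψ(x · T y) = 1 ∀ x ∈ B₁}` form
a dual lattice pair for the pairing `ψ(x · T y)`: `B₁^⊥` is compact open and `^⊥(B₁^⊥) = B₁` (separation).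
[cite: MoeglinVignerasWaldspurger1987, Chap. 2 I.3] -/
theorem isDualLatticePair_closedBall_charDual (hT : IsUnit T.det) (hψc : Continuous ψ) (hψ1 : ∃ t, ψ t ≠ 1) :
    IsDualLatticePair (Matrix.toLinearMap₂' F T) ψ
      (IsUltrametricDist.closedBall_openAddSubgroup (Fin n → F) one_pos).toAddSubgroup
      (charDual T ψ (Metric.closedBall (0 : Fin n → F) 1)) where
  isCompact_left := isCompact_closedBall _ _
  isOpen_left := IsUltrametricDist.isOpen_closedBall _ one_ne_zero
  isCompact_right := isCompact_charDual_closedBall T ψ hψc hT hψ1 one_pos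
  isOpen_right := isOpen_charDual T ψ hψc one_pos subset_rfl
  mem_right_iff y := by
    rw [mem_charDual]
    exact forall₂_congr fun x _ => by rw [Matrix.toLinearMap₂'_apply']
  mem_left_iff x := by
    constructor
    · intro hx y hy
      rw [Matrix.toLinearMap₂'_apply']
      exact hy x hx
    · intro hx
      by_contra hxn
      have hx1 : 1 < ‖x‖ := not_le.1 fun h => hxn (mem_closedBall_zero_iff.2 h)
      obtain ⟨y, hy, hne⟩ := exists_mem_charDual_apply_ne_one T ψ hψc hT hψ1 one_pos hx1
      exact hne (by rw [← Matrix.toLinearMap₂'_apply']; exact hx y hy)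

/-! ## §2 Unit scalings of bounded subgroups shrink to `0` -/

omit [IsUltrametricDist F] [ProperSpace F] in
/-- **small scalings**: if `F` has an element `c` with `0 < ‖c‖ < 1`, then for every bounded additive subgroup `S` of
`Fⁿ` and every neighbourhood `N` of `0` some unit scaling `cᵏ S` lies in `N` (`‖cᵏ s‖ ≤ ‖c‖ᵏ R → 0`).
[cite: Weil1964, Chap. I n° 11] -/
theorem exists_units_smul_addSubgroup_subset (hF : ∃ c : F, 0 < ‖c‖ ∧ ‖c‖ < 1) (S : AddSubgroup (Fin n → F))
    (hS : Bornology.IsBounded (S : Set (Fin n → F))) (N : Set (Fin n → F)) (hN : N ∈ 𝓝 (0 : Fin n → F)) :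
    ∃ a : Fˣ, (((a : F) • S : AddSubgroup (Fin n → F)) : Set (Fin n → F)) ⊆ N := by
  obtain ⟨c, hc0, hc1⟩ := hF
  obtain ⟨ε, hε, hεN⟩ := Metric.mem_nhds_iff.1 hN
  obtain ⟨R, hR⟩ := hS.subset_closedBall 0
  have hR1 : 0 < max R 1 := lt_of_lt_of_le one_pos (le_max_right _ _)
  obtain ⟨k, hk⟩ := exists_pow_lt_of_lt_one (div_pos hε hR1) hc1
  have hck : c ^ k ≠ 0 := pow_ne_zero _ (norm_pos_iff.1 hc0)
  refine ⟨Units.mk0 (c ^ k) hck, fun x hx => hεN ?_⟩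
  obtain ⟨s, hs, rfl⟩ := (AddSubgroup.mem_smul_pointwise_iff_exists _ _ _).1 hx
  rw [Units.val_mk0, mem_ball_zero_iff, norm_smul, norm_pow]
  have hsR : ‖s‖ ≤ max R 1 := (mem_closedBall_zero_iff.1 (hR hs)).trans (le_max_left _ _)
  calc ‖c‖ ^ k * ‖s‖ ≤ ‖c‖ ^ k * max R 1 := by gcongr
    _ < ε / max R 1 * max R 1 := by gcongr
    _ = ε := div_mul_cancel₀ ε hR1.ne'

omit [ProperSpace F] in
/-- the unit ball's scalings shrink to `0`. [cite: Weil1964, Chap. I n° 11] -/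
theorem exists_units_smul_closedBall_subset (hF : ∃ c : F, 0 < ‖c‖ ∧ ‖c‖ < 1) (N : Set (Fin n → F))
    (hN : N ∈ 𝓝 (0 : Fin n → F)) :
    ∃ a : Fˣ, (((a : F) • (IsUltrametricDist.closedBall_openAddSubgroup (Fin n → F) one_pos).toAddSubgroup :
      AddSubgroup (Fin n → F)) : Set (Fin n → F)) ⊆ N :=
  exists_units_smul_addSubgroup_subset hF _ Metric.isBounded_closedBall N hN

/-- the dual ball's scalings shrink to `0` (`B₁^⊥` is compact, hence bounded). [cite: Weil1964, Chap. I n° 11] -/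
theorem exists_units_smul_charDual_subset (hT : IsUnit T.det) (hψc : Continuous ψ)
    (hψ1 : ∃ t, ψ t ≠ 1) (hF : ∃ c : F, 0 < ‖c‖ ∧ ‖c‖ < 1) (N : Set (Fin n → F)) (hN : N ∈ 𝓝 (0 : Fin n → F)) :
    ∃ a : Fˣ, (((a : F) • charDual T ψ (Metric.closedBall (0 : Fin n → F) 1) : AddSubgroup (Fin n → F)) :
      Set (Fin n → F)) ⊆ N :=
  exists_units_smul_addSubgroup_subset hF _ (isCompact_charDual_closedBall T ψ hψc hT hψ1 one_pos).isBounded N hN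

/-! ## §3 Model-free uniqueness at a finite place -/

/-- **uniqueness of the irreducible unitary `ψ`-representation of `H(𝕎_v)`, model-free form.**  `F` a non-archimedean
normed field with compact closed balls and an element of norm in `(0, 1)`, `T ∈ GL_n(F)`, `ψ` continuous and
non-trivial.  Any two representations `π₁`, `π₂` of `H = Heisenberg (polar β_T)` on complex Hilbert spaces `E₁, E₂ ≠ 0`
by linear isometries, with continuous orbit maps `w ↦ πᵢ(w, 0) v`, central character `ψ` and no closed invariant
subspaces other than `⊥`, `⊤`, are unitarily equivalent: `U : E₁ ≃ₗᵢ[ℂ] E₂` with `U (π₁ h v) = π₂ h (U v)` — "`ρ_ψ` …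
(unique up to isomorphism)" at a finite place, by the lattice pair `(B₁, B₁^⊥)` alone.
[cite: MoeglinVignerasWaldspurger1987, Chap. 2 I.2 Théorème (Stone, Von Neumann)] -/
theorem exists_linearIsometryEquiv_of_irreducible_of_irreducible_nonarch (hT : IsUnit T.det) (hψc : Continuous ψ)
    (hψ1 : ∃ t, ψ t ≠ 1) (hF : ∃ c : F, 0 < ‖c‖ ∧ ‖c‖ < 1)
    {E₁ : Type*} [NormedAddCommGroup E₁] [InnerProductSpace ℂ E₁] [CompleteSpace E₁] [Nontrivial E₁]
    {E₂ : Type*} [NormedAddCommGroup E₂] [InnerProductSpace ℂ E₂] [CompleteSpace E₂] [Nontrivial E₂]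
    (π₁ : Representation ℂ (Heisenberg (polar (Matrix.toLinearMap₂' F T))) E₁)
    (π₂ : Representation ℂ (Heisenberg (polar (Matrix.toLinearMap₂' F T))) E₂)
    (h₁u : ∀ (h : Heisenberg (polar (Matrix.toLinearMap₂' F T))) (v : E₁), ‖π₁ h v‖ = ‖v‖)
    (h₁c : ∀ v : E₁, Continuous fun w : (Fin n → F) × (Fin n → F) => π₁ ⟨w, 0⟩ v)
    (h₁z : ∀ (t : F) (v : E₁), π₁ (Heisenberg.ofCenter (polar (Matrix.toLinearMap₂' F T)) (Multiplicative.ofAdd t)) v =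
      ((ψ t : Circle) : ℂ) • v)
    (h₁i : ∀ K : Submodule ℂ E₁, IsClosed (K : Set E₁) →
      (∀ (h : Heisenberg (polar (Matrix.toLinearMap₂' F T))), ∀ v ∈ K, π₁ h v ∈ K) → K = ⊥ ∨ K = ⊤)
    (h₂u : ∀ (h : Heisenberg (polar (Matrix.toLinearMap₂' F T))) (v : E₂), ‖π₂ h v‖ = ‖v‖)
    (h₂c : ∀ v : E₂, Continuous fun w : (Fin n → F) × (Fin n → F) => π₂ ⟨w, 0⟩ v)
    (h₂z : ∀ (t : F) (v : E₂), π₂ (Heisenberg.ofCenter (polar (Matrix.toLinearMap₂' F T)) (Multiplicative.ofAdd t)) v =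
      ((ψ t : Circle) : ℂ) • v)
    (h₂i : ∀ K : Submodule ℂ E₂, IsClosed (K : Set E₂) →
      (∀ (h : Heisenberg (polar (Matrix.toLinearMap₂' F T))), ∀ v ∈ K, π₂ h v ∈ K) → K = ⊥ ∨ K = ⊤) :
    ∃ U : E₁ ≃ₗᵢ[ℂ] E₂, ∀ (h : Heisenberg (polar (Matrix.toLinearMap₂' F T))) (v : E₁), U (π₁ h v) = π₂ h (U v) :=
  exists_linearIsometryEquiv_of_irreducible_of_isDualLatticePair (Matrix.toLinearMap₂' F T) ψ
    (isDualLatticePair_closedBall_charDual T ψ hT hψc hψ1) (exists_units_smul_closedBall_subset hF)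
    (exists_units_smul_charDual_subset T ψ hT hψc hψ1 hF) π₁ π₂ h₁u h₁c h₁z h₁i h₂u h₂c h₂z h₂i

end Literature.RepresentationTheory.HeisenbergGroup

end
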